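import Summits.FinalStateConjecture.FinalStateConjecture.Theorems.PhotonSphereChannelsChannelsResolveTameDevelopmentsRKerrDocIsometry
import Summits.FinalStateConjecture.FinalStateConjecture.Theorems.PhotonSphereChannelsChannelsResolveTameDevelopmentsRHorizonHullCurvature
import Summits.FinalStateConjecture.FinalStateConjecture.Theorems.PhotonSphereChannelsChannelsResolveTameDevelopmentsRKerrDocSpinFlip
import HarnessLib

/-!
# Route PhotonSphereChannels · crux `ChannelsResolveTameDevelopmentsR` (K2R-T2, stmt-FinalStateConjecture-17430) —
# (U) `KerrDocParamUniqueOn` PROVED: the sub-extremal Kerr parameters of a region are unique up to the sign of `a`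

Input (U) of the reductions of stub K (`…RKerrLocusReduction.lean`: (C) ⇐ (U) ∧ (S)) and of stub K♭
(`…RKerrParametersConstantAlong.lean` / `…RKerrDocSpinFlip.lean`: K♭ ⇐ (B1)+(B2)+(B4)+(U)) of the lines
`dark-future-exactness` / `tame-lasalle-dock`: `DarkFuture.KerrDocParamUniqueOn 𝓢 O` — if `O ⊆ 𝓢` is an exact Kerr
`(M, a)` exterior and an exact Kerr `(M', a')` exterior (`TameHull.IsKerrDoc`, both sub-extremal) then `M' = M` and
`|a'| = |a|`. This file DISCHARGES it for every spacetime and every region (`kerrDocParamUniqueOn`), from two isometry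
invariants of a sub-extremal Kerr exterior:

* §1 **The supremum of the Kretschmann scalar is `48M²/r₊⁶`.** On the image of an exact chart `|Rm|²_𝓢` is Kerr's
  `48M² Re (r + ia cos θ)⁶/Σ⁶` (`DarkFuture.kretschmannAt_kerrChart`), which is `≤ 48M²/Σ³ ≤ 48M²/r⁶ < 48M²/r₊⁶`
  (`|Re z⁶| ≤ |z|⁶ = Σ³`) and equals `48M²/r⁶` on the equator, `r → r₊⁺`; so two exact charts of ONE region have
  `M²/r₊⁶ = M'²/r₊'⁶` (`sq_div_rPlus_pow_six_eq_of_isKerrDoc`).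
* §2 **(U) proved** (`kerrDocParamUniqueOn`, registered sub-goal of stub K♭): with the first relation `M/r₊ = M'/r₊'`
  of the companion file (`div_rPlus_eq_of_isKerrDoc`, Killing algebra of rotating Kerr, applied on whichever side
  rotates; for `a = a' = 0`, `r₊ = 2M` makes it trivial) the two relations give `r₊ = r₊'`, `M = M'`, `a² = a'²`.
* §3 Consequences: (C) `KerrDocParamClosedOn` for every region (`kerrDocParamClosedOn`), hence stub K of the sibling line
  from the transport (T) ALONE (`kerrLocusClopen_of_transport`); and stub K♭'s registered text from (B1)+(B2)+(B4) ALONE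
  (`kerrParametersConstantAlong_of_closedLoci_of_pinned''`) — (U) and (S) are no longer owed on the topological route.

What K♭ still owes after this file (reported to the lead): unique pinning (UP) `KerrParametersUniqueUpToSpinAlong` on the
topology-free route, or the hull topology (B1)+(B2) with the budget (B4) on the topological route — statements about the
DEVELOPMENT along `γ` (horizon lineage / area theorem), not about one region.

References: M. Visser, arXiv:0706.0622, §3 [arXiv07060622]; B. O'Neill, *The Geometry of Kerr Black Holes* (1995), Ch. 3
Cor. 3.7.4 [ONeill1995]; Dafermos–Luk 2017, Conjecture 1 [DafermosLuk2017]; Hale 1980, Ch. I §8 [Hale1980].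
-/

noncomputable section

-- the operator-norm instance on `E4 →L[ℝ] E4 →L[ℝ] ℝ` needs one more level of pending
-- instance problems than the default (as in `PhotonSphereChannelsTameHullDefs.lean`)
set_option maxSynthPendingDepth 3
-- every `Summit.FinalStateConjecture.FinalStateConjecture.…` name repeats the summit = sub-problem segment (D-0017 layout)
set_option linter.dupNamespace false

open Set Filter Function TopologicalSpace Manifold Bundle
open scoped Topology Manifold ContDiff ENNReal NNReal

namespace Summit.FinalStateConjecture.FinalStateConjecture.Theorems.TameLaSalle

open Literature.Geometry.Lorentzian Literature.Barriers.FinalStateConjecture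
open Summit.FinalStateConjecture.FinalStateConjecture.Theorems.TameHull
open Summit.FinalStateConjecture.FinalStateConjecture.Theorems.DarkFuture

/-! ### §1 The supremum of the Kretschmann scalar of an exact Kerr d.o.c. is `48M²/r₊⁶` -/

/-- **`|Rm|²_{g_{M,a}} ≤ 48M²/r⁶` on the Kerr–Schild chart** (`r > 0`): the closed form is
`48M² Re (r + i a cos θ)⁶/(r² + a²cos²θ)⁶`, and `Re z⁶ ≤ |z|⁶ = (r² + a²cos²θ)³`, `r² ≤ r² + a²cos²θ`.
[cite: arXiv07060622, §3] -/
theorem rmNormSqAt_kerr_le {M a : ℝ} {x : E4} (hx : 0 < Kerr.radius a x) :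
    MetricCoord.rmNormSqAt (Kerr.bilin M a) x ≤ 48 * M ^ 2 / Kerr.radius a x ^ 6 := by
  rw [Kerr.kretschmannScalar_closedForm_holds M a x hx]
  set r := Kerr.radius a x with hr_def
  set t : ℝ := a * (x 3 / r) with ht_def
  have hz2 : ‖((r : ℂ) + (t : ℂ) * Complex.I)‖ ^ 2 = r ^ 2 + t ^ 2 := by
    rw [Complex.sq_norm, Complex.normSq_add_mul_I]
  have hre : (((r : ℂ) + (t : ℂ) * Complex.I) ^ 6).re ≤ (r ^ 2 + t ^ 2) ^ 3 :=
    calc (((r : ℂ) + (t : ℂ) * Complex.I) ^ 6).re ≤ ‖((r : ℂ) + (t : ℂ) * Complex.I) ^ 6‖ := Complex.re_le_norm _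
      _ = (‖(r : ℂ) + (t : ℂ) * Complex.I‖ ^ 2) ^ 3 := by rw [norm_pow]; ring
      _ = (r ^ 2 + t ^ 2) ^ 3 := by rw [hz2]
  have hpos : 0 < r ^ 2 + t ^ 2 := by positivity
  have hr6 : 0 < r ^ 6 := by positivity
  calc 48 * M ^ 2 * (((r : ℂ) + (t : ℂ) * Complex.I) ^ 6).re / (r ^ 2 + t ^ 2) ^ 6
      ≤ 48 * M ^ 2 * (r ^ 2 + t ^ 2) ^ 3 / (r ^ 2 + t ^ 2) ^ 6 :=
        div_le_div_of_nonneg_right (mul_le_mul_of_nonneg_left hre (by positivity)) (by positivity)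
    _ = 48 * M ^ 2 / (r ^ 2 + t ^ 2) ^ 3 := by
        field_simp
    _ ≤ 48 * M ^ 2 / r ^ 6 := by
        refine div_le_div_of_nonneg_left (by positivity) hr6 ?_
        calc r ^ 6 = (r ^ 2) ^ 3 := by ring
          _ ≤ (r ^ 2 + t ^ 2) ^ 3 := pow_le_pow_left₀ (sq_nonneg r) (by nlinarith [sq_nonneg t]) 3

section Sup

variable {𝓢 : Spacetime.{0} 4} {O : Set 𝓢.carrier}

/-- **`|Rm|²_𝓢 < 48M²/r₊⁶` on an exact Kerr `(M, a)` d.o.c.** (`M > 0`): every point of `O` is a chart point with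
`r > r₊ > 0`, where `|Rm|²_𝓢 = |Rm|²_{g_{M,a}} ≤ 48M²/r⁶` (`HullCurvature.exists_kretschmannAt_eq_of_isKerrDoc`,
`rmNormSqAt_kerr_le`). [cite: arXiv07060622, §3] -/
theorem kretschmannAt_lt_of_isKerrDoc {M a : ℝ} (hM : 0 < M) (h : IsKerrDoc 𝓢 O M a) {y : 𝓢.carrier} (hy : y ∈ O) :
    𝓢.kretschmannAt y < 48 * M ^ 2 / Kerr.rPlus M a ^ 6 := by
  obtain ⟨x, hx, hK⟩ := HullCurvature.exists_kretschmannAt_eq_of_isKerrDoc h hM.le hy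
  have hrp := Kerr.rPlus_pos hM a
  have hr : Kerr.rPlus M a < Kerr.radius a x := Kerr.lt_radius_of_mem_region hx
  rw [hK]
  exact (rmNormSqAt_kerr_le (hrp.trans hr)).trans_lt
    (div_lt_div_of_pos_left (by positivity) (by positivity) (pow_lt_pow_left₀ hr hrp.le (by norm_num)))

/-- **`48M²/r₊⁶` is approached by `|Rm|²_𝓢` on an exact Kerr `(M, a)` d.o.c.** (`M > 0`): the image of the equatorial
chart point of radius `r` has `|Rm|²_𝓢 = 48M²/r⁶` (`DarkFuture.kretschmannAt_kerrChart`,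
`Kerr.kretschmannScalar_equatorial`), and `r → r₊⁺`. [cite: arXiv07060622, §3] -/
theorem exists_lt_kretschmannAt_of_isKerrDoc {M a : ℝ} (hM : 0 < M) (h : IsKerrDoc 𝓢 O M a) {ε : ℝ} (hε : 0 < ε) :
    ∃ y ∈ O, 48 * M ^ 2 / Kerr.rPlus M a ^ 6 - ε < 𝓢.kretschmannAt y := by
  obtain ⟨Ψ, -, hsmooth, hrange, hdev, -⟩ := h
  have hrp := Kerr.rPlus_pos hM a
  have hcont : Tendsto (fun r : ℝ ↦ 48 * M ^ 2 / r ^ 6) (𝓝[>] Kerr.rPlus M a)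
      (𝓝 (48 * M ^ 2 / Kerr.rPlus M a ^ 6)) :=
    (tendsto_const_nhds.div (tendsto_id.pow 6) (by positivity)).mono_left nhdsWithin_le_nhds
  have h1 : ∀ᶠ r in 𝓝[>] Kerr.rPlus M a, 48 * M ^ 2 / Kerr.rPlus M a ^ 6 - ε < 48 * M ^ 2 / r ^ 6 :=
    hcont.eventually (lt_mem_nhds (by linarith))
  obtain ⟨r, hr1, hr2⟩ := (h1.and eventually_mem_nhdsWithin).exists
  have hr2' : Kerr.rPlus M a < r := hr2
  have hr0 : 0 < r := hrp.trans hr2'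
  have hrad : Kerr.radius a (equatorialPoint √(r ^ 2 + a ^ 2)) = r := radius_equatorialPoint hr0
  have hmem : equatorialPoint √(r ^ 2 + a ^ 2) ∈ Kerr.region a (Kerr.rPlus M a) := by
    rw [Kerr.mem_region, hrad]
    exact max_lt hr2' hr0
  refine ⟨Ψ ⟨equatorialPoint √(r ^ 2 + a ^ 2), hmem⟩, hrange ▸ mem_range_self _, ?_⟩
  rw [kretschmannAt_kerrChart hM.le hsmooth hdev, Kerr.kretschmannScalar_equatorial
    Kerr.kretschmannScalar_closedForm_holds M a (hrad.symm ▸ hr0) (equatorialPoint_apply_three _), hrad]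
  exact hr1

/-- **Second parameter relation: two exact Kerr charts of ONE region have `M²/r₊⁶ = M'²/r₊'⁶`** (both suprema of
`|Rm|²_𝓢` over `O` are `48M²/r₊⁶` resp. `48M'²/r₊'⁶`). [cite: arXiv07060622, §3] -/
theorem sq_div_rPlus_pow_six_eq_of_isKerrDoc {M a M' a' : ℝ} (hM : 0 < M) (hM' : 0 < M') (h : IsKerrDoc 𝓢 O M a)
    (h' : IsKerrDoc 𝓢 O M' a') : M ^ 2 / Kerr.rPlus M a ^ 6 = M' ^ 2 / Kerr.rPlus M' a' ^ 6 := by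
  have key : 48 * M ^ 2 / Kerr.rPlus M a ^ 6 = 48 * M' ^ 2 / Kerr.rPlus M' a' ^ 6 := by
    refine le_antisymm (le_of_forall_pos_lt_add fun ε hε ↦ ?_) (le_of_forall_pos_lt_add fun ε hε ↦ ?_)
    · obtain ⟨y, hy, h1⟩ := exists_lt_kretschmannAt_of_isKerrDoc hM h hε
      linarith [kretschmannAt_lt_of_isKerrDoc hM' h' hy]
    · obtain ⟨y, hy, h1⟩ := exists_lt_kretschmannAt_of_isKerrDoc hM' h' hε
      linarith [kretschmannAt_lt_of_isKerrDoc hM h hy]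
  have e1 : M ^ 2 / Kerr.rPlus M a ^ 6 = 48 * M ^ 2 / Kerr.rPlus M a ^ 6 / 48 := by ring
  rw [e1, key]
  ring

end Sup

/-! ### §2 (U) proved: the sub-extremal Kerr parameters of a region are unique up to the sign of `a` -/

/-- **The two relations pin `(M, |a|)`**: for sub-extremal `(M, a)`, `(M', a')`, `M/r₊ = M'/r₊'` and
`M²/r₊⁶ = M'²/r₊'⁶` force `M' = M` and `|a'| = |a|` (`M'²r₊²r₊'⁴ = M'²r₊⁶` gives `r₊ = r₊'`, then `M = M'`, then
`√(M² − a²) = √(M² − a'²)`). [folklore] -/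
theorem kerrParams_eq_of_relations {M a M' a' : ℝ} (hMa : Kerr.IsSubextremal M a) (hMa' : Kerr.IsSubextremal M' a')
    (h1 : M / Kerr.rPlus M a = M' / Kerr.rPlus M' a') (h2 : M ^ 2 / Kerr.rPlus M a ^ 6 = M' ^ 2 / Kerr.rPlus M' a' ^ 6) :
    M' = M ∧ |a'| = |a| := by
  have hM := hMa.pos
  have hM' := hMa'.pos
  have hsub : 0 < M ^ 2 - a ^ 2 := by nlinarith [abs_nonneg a, abs_lt.1 hMa, sq_abs a]
  have hsub' : 0 < M' ^ 2 - a' ^ 2 := by nlinarith [abs_nonneg a', abs_lt.1 hMa', sq_abs a']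
  have hR : Kerr.rPlus M a = M + √(M ^ 2 - a ^ 2) := rfl
  have hR' : Kerr.rPlus M' a' = M' + √(M' ^ 2 - a' ^ 2) := rfl
  rw [hR, hR'] at h1 h2
  have e1 : √(M ^ 2 - a ^ 2) ^ 2 = M ^ 2 - a ^ 2 := Real.sq_sqrt hsub.le
  have e2 : √(M' ^ 2 - a' ^ 2) ^ 2 = M' ^ 2 - a' ^ 2 := Real.sq_sqrt hsub'.le
  have hs0 : 0 ≤ √(M ^ 2 - a ^ 2) := Real.sqrt_nonneg _
  have hs0' : 0 ≤ √(M' ^ 2 - a' ^ 2) := Real.sqrt_nonneg _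
  generalize √(M ^ 2 - a ^ 2) = s at h1 h2 e1 hs0
  generalize √(M' ^ 2 - a' ^ 2) = s' at h1 h2 e2 hs0'
  have hRpos : 0 < M + s := by positivity
  have hR'pos : 0 < M' + s' := by positivity
  rw [div_eq_div_iff hRpos.ne' hR'pos.ne'] at h1
  rw [div_eq_div_iff (by positivity) (by positivity)] at h2
  -- `(M + s)⁴ = (M' + s')⁴`, hence `M + s = M' + s'`
  have h4 : (M + s) ^ 4 = (M' + s') ^ 4 := by
    have h3 : M' ^ 2 * (M + s) ^ 2 * (M' + s') ^ 4 = M' ^ 2 * (M + s) ^ 2 * (M + s) ^ 4 := by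
      have e : M ^ 2 * (M' + s') ^ 6 = (M * (M' + s')) ^ 2 * (M' + s') ^ 4 := by ring
      rw [e, h1] at h2
      linear_combination h2
    have hne : M' ^ 2 * (M + s) ^ 2 ≠ 0 := by positivity
    exact (mul_left_cancel₀ hne h3).symm
  have hRR : M + s = M' + s' := (pow_left_inj₀ hRpos.le hR'pos.le (by norm_num : (4 : ℕ) ≠ 0)).1 h4
  -- `M = M'`, `s = s'`, `a² = a'²`
  have hMM : M = M' := by
    rw [hRR] at h1
    exact mul_right_cancel₀ hR'pos.ne' h1
  subst hMM
  have hss : s = s' := by linarith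
  subst hss
  have haa : a' ^ 2 = a ^ 2 := by linarith
  exact ⟨rfl, (sq_eq_sq_iff_abs_eq_abs a' a).1 haa⟩

/-- **(U) `KerrDocParamUniqueOn` holds for every spacetime and every region** (registered sub-goal of stub K♭; discharges
input (U) of the reductions of stubs K and K♭): if `O ⊆ 𝓢` is an exact Kerr `(M, a)` exterior and an exact Kerr
`(M', a')` exterior, both sub-extremal, then `M' = M` and `|a'| = |a|`. The transition map `Ψ'⁻¹ ∘ Ψ` is an isometry of
the two Kerr exteriors; the supremum of `|Rm|²` gives `M²/r₊⁶ = M'²/r₊'⁶` (`sq_div_rPlus_pow_six_eq_of_isKerrDoc`), the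
Killing algebra of the rotating side gives `M/r₊ = M'/r₊'` (`div_rPlus_eq_of_isKerrDoc`; if `a = a' = 0`, `r₊ = 2M` and
`r₊' = 2M'`), and the two relations pin `(M, |a|)` (`kerrParams_eq_of_relations`).
[cite: ONeill1995, Ch. 3 §3.7, Cor. 3.7.4] -/
theorem kerrDocParamUniqueOn : ∀ (𝓢 : Spacetime.{0} 4) (O : Set 𝓢.carrier), KerrDocParamUniqueOn 𝓢 O := by
  intro 𝓢 O M a M' a' hM ha hM' ha' hk hk'
  have hMa : Kerr.IsSubextremal M a := ha
  have hMa' : Kerr.IsSubextremal M' a' := ha'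
  have h2 := sq_div_rPlus_pow_six_eq_of_isKerrDoc hM hM' hk hk'
  have h1 : M / Kerr.rPlus M a = M' / Kerr.rPlus M' a' := by
    by_cases ha0 : a = 0
    · by_cases ha0' : a' = 0
      · subst ha0 ha0'
        rw [Kerr.rPlus_zero_right hM.le, Kerr.rPlus_zero_right hM'.le]
        field_simp
      · exact (div_rPlus_eq_of_isKerrDoc 𝓢 O M' a' M a ha0' hMa' hMa hk' hk).symm
    · exact div_rPlus_eq_of_isKerrDoc 𝓢 O M a M' a' ha0 hMa hMa' hk hk'
  exact kerrParams_eq_of_relations hMa hMa' h1 h2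

/-! ### §3 Consequences for stubs K and K♭ -/

/-- **(U) for the d.o.c. of every end** (the form consumed by `kerrParametersConstantAlong_of_closedLoci_of_pinned_of_unique'`,
`isKerrDoc_along_of_closedLoci_of_pinned_of_unique`). [cite: ONeill1995, Ch. 3 §3.7, Cor. 3.7.4] -/
theorem kerrDocParamUniqueOn_doc : ∀ (𝓢 : Spacetime.{0} 4) (E : EndDatum 𝓢), KerrDocParamUniqueOn 𝓢 E.doc :=
  fun 𝓢 E ↦ kerrDocParamUniqueOn 𝓢 E.doc

/-- **(C) `KerrDocParamClosedOn` holds for every region**: the sub-extremal Kerr parameters of a region are closed under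
approximation ((C) ⇐ (U) ∧ (S), both now proved: `kerrDocParamClosedOn_of_unique`). [cite: DafermosLuk2017, Conjecture 1] -/
theorem kerrDocParamClosedOn (𝓢 : Spacetime.{0} 4) (O : Set 𝓢.carrier) : KerrDocParamClosedOn 𝓢 O :=
  kerrDocParamClosedOn_of_unique (kerrDocParamUniqueOn 𝓢 O)

/-- **Stub K of the sibling line `dark-future-exactness` from the transport (T) ALONE** (K's registered text VERBATIM as the
conclusion; its second input (C) of `kerrLocusClopen_of_transport_of_paramClosed` is discharged by `kerrDocParamClosedOn`).
[cite: Hale1980, Ch. I §8 Thm. 8.1] -/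
theorem kerrLocusClopen_of_transport : (∀ {X : Type} [TopologicalSpace X] [ChartedSpace E3 X] [IsManifold (𝓡 3) ∞ X] [T2Space X] [SecondCountableTopology X] [ConnectedSpace X] {D : InitialDataSet (𝓡 3) X}, D ∈ admissibleVacuumData X → ∀ (𝒟 : VacuumCauchyDevelopment D) [𝒟.metric.HasLeviCivita], DevHyp 𝒟 → ∀ (Λ : ℕ → ℝ≥0) (r₀ : ℝ), 0 < r₀ → GeneratorHullExists 𝒟 Λ r₀ → ∀ γ : ℝ → 𝒟.carrier, IsHorizonPath 𝒟 γ → OpennessTransportAlong 𝒟 Λ r₀ γ) → ∀ (X : Type) [TopologicalSpace X] [ChartedSpace E3 X] [IsManifold (𝓡 3) ∞ X] [T2Space X] [SecondCountableTopology X] [ConnectedSpace X], ∀ D ∈ admissibleVacuumData X, ∀ (𝒟 : VacuumCauchyDevelopment D) [𝒟.metric.HasLeviCivita], DevHyp 𝒟 → ∀ (Λ : ℕ → ℝ≥0) (r₀ : ℝ), 0 < r₀ → GeneratorHullExists 𝒟 Λ r₀ → WindowIsolationAlong 𝒟 Λ r₀ → ∀ γ : ℝ → 𝒟.carrier, IsHorizonPath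 𝒟 γ → (∃ (𝓢 : Spacetime.{0} 4) (E : EndDatum 𝓢) (p : 𝓢.carrier), IsHorizonHullElement 𝒟 Λ r₀ γ 𝓢 E p ∧ ∃ M a : ℝ, 0 < M ∧ |a| < M ∧ IsKerrDoc 𝓢 E.doc M a) → ∃ M a : ℝ, 0 < M ∧ |a| < M ∧ ∀ (𝓢 : Spacetime.{0} 4) (E : EndDatum 𝓢) (p : 𝓢.carrier), IsHorizonHullElement 𝒟 Λ r₀ γ 𝓢 E p → IsKerrDoc 𝓢 E.doc M a :=
  fun hT ↦ kerrLocusClopen_of_transport_of_paramClosed hT fun 𝓢 E ↦ kerrDocParamClosedOn 𝓢 E.doc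

/-- **Stub K♭ from (B1)+(B2) hull topology and (B4) pinning ALONE** (registered sub-goal of stub K♭; K♭'s registered text
VERBATIM as the conclusion): with (U) `kerrDocParamUniqueOn_doc` and (S) `kerrDocSpinFlipOn_doc` proved, the topological
route `kerrParametersConstantAlong_of_closedLoci_of_pinned_of_unique'` needs only SOME preconnected topology on the based hull
`Ω_γ` with closed sub-extremal Kerr loci, and finite pinning, for every development as in Φ, class and horizon generator path.
[cite: Hale1980, Ch. I §8 Thm. 8.1] -/
theorem kerrParametersConstantAlong_of_closedLoci_of_pinned'' : (∀ {X : Type} [TopologicalSpace X] [ChartedSpace E3 X] [IsManifold (𝓡 3) ∞ X] [T2Space X] [SecondCountableTopology X] [ConnectedSpace X] {D : InitialDataSet (𝓡 3) X}, D ∈ admissibleVacuumData X → ∀ (𝒟 : VacuumCauchyDevelopment D) [𝒟.metric.HasLeviCivita], DevHyp 𝒟 → ∀ (Λ : ℕ → ℝ≥0) (r₀ : ℝ), 0 < r₀ → GeneratorHullExists 𝒟 Λ r₀ → ∀ γ : ℝ → 𝒟.carrier, IsHorizonPath 𝒟 γ → (∃ τ : TopologicalSpace (HullElt 𝒟 Λ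 r₀ γ), @PreconnectedSpace (HullElt 𝒟 Λ r₀ γ) τ ∧ ∀ M a : ℝ, 0 < M → |a| < M → IsClosed[τ] {Z : HullElt 𝒟 Λ r₀ γ | IsKerrDoc Z.𝓢 Z.E.doc M a}) ∧ KerrParametersPinnedAlong 𝒟 Λ r₀ γ) → ∀ (X : Type) [TopologicalSpace X] [ChartedSpace E3 X] [IsManifold (𝓡 3) ∞ X] [T2Space X] [SecondCountableTopology X] [ConnectedSpace X], ∀ D ∈ admissibleVacuumData X, ∀ (𝒟 : VacuumCauchyDevelopment D) [𝒟.metric.HasLeviCivita], DevHyp 𝒟 → ∀ (Λ : ℕ → ℝ≥0) (r₀ : ℝ), 0 < r₀ → GeneratorHullExists 𝒟 Λ r₀ → ∀ γ : ℝ → 𝒟.carrier, IsHorizonPath 𝒟 γ → (∀ (𝓢 : Spacetime.{0} 4) (E : EndDatum 𝓢) (p : 𝓢.carrier), IsHorizonHullElement 𝒟 Λ r₀ γ 𝓢 E p → ∃ M a : ℝ, 0 < M ∧ |a| < M ∧ IsKerrDoc 𝓢 E.doc M a) → ∃ M a : ℝ, 0 < M ∧ |a| < M ∧ ∀ (𝓢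 : Spacetime.{0} 4) (E : EndDatum 𝓢) (p : 𝓢.carrier), IsHorizonHullElement 𝒟 Λ r₀ γ 𝓢 E p → IsKerrDoc 𝓢 E.doc M a :=
  fun hB ↦ kerrParametersConstantAlong_of_closedLoci_of_pinned_of_unique' hB kerrDocParamUniqueOn_doc

end Summit.FinalStateConjecture.FinalStateConjecture.Theorems.TameLaSalle

end
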